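import Mathlib
import Literature.LinearAlgebra.Matrix.HermitianRankOneExpansion
import Literature.LinearAlgebra.Matrix.CoordinateBessel

/-!
# Converse of line `frame-negativity-singlet-fraction`, part I: partial transpose, sign operators and the KEY INEQUALITY

Crux `FidelityWitnesses.DiagonalPowerDecay` (stmt-MatrixMultiplication-14053), lead prover-line-stmt-MatrixMultiplication-14053-0.
Towards `DiagonalPowerDecay ⇒ stub_middlePairNegativityDecay` (the open stub is EQUIVALENT to the crux): pure matrix
analysis on `ℂ^n ⊗ ℂ^n` in coordinates `Fin n × Fin n`.
* `ptr` — partial transpose on the second factor, `(ptr M) (μ,μ') (λ,λ') = M (μ,λ') (λ,μ')`; reindexing lemma; Hermitian.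
* `signOp hH = Σ_i ε_i |u_i⟩⟨u_i|` (signs of the eigenvalues): Hermitian, a contraction, and
  `Σ_i ε_i ⟨u_i, (ptr R) u_i⟩ = Σ_{p,q} R p q · (ptr signOp) q p` (`sum_sign_quadform_eq_trace`).
* **KEY INEQUALITY** (`nsq_ptr_mulVec_le`, registered unfolded form `keyInequality`): for a Hermitian contraction `X`,
  an orthonormal frame `b` of the first factor and any `φ`: `‖(ptr X) φ‖² ≤ n (Σ_j ‖row_j φ‖)²` — the `(μ,λ)` blocks of a
  Hermitian contraction are contractions, so each slice of `(ptr X) φ` is a sum over `j` of vectors of norm `≤ ‖row_j φ‖`.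
* `frob_partial_eigen`: `‖Σ_{i∈Λ} μ_i |φ_i⟩⟨φ_i|‖_F² = Σ_{i∈Λ} μ_i²`.
-/

noncomputable section

-- the tree's namespace `Summit.MatrixMultiplication.MatrixMultiplication.…` repeats a component by design
set_option linter.dupNamespace false

namespace Summit.MatrixMultiplication.MatrixMultiplication.Theorems.DiagonalPowerDecay

open scoped BigOperators ComplexConjugate ComplexOrder
open Matrix Literature.LinearAlgebra.Matrix
open Literature.Probability.RandomMatrix (nsq nsq_nonneg)

/-! ## Partial transpose, sign operators and the key inequality -/

section Ptr

variable {n : ℕ}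

/-- The PARTIAL TRANSPOSE (on the second tensor factor) of an operator on `ℂ^n ⊗ ℂ^n`:
`(ptr M) (μ,μ') (λ,λ') = M (μ,λ') (λ,μ')`. -/
def ptr (M : Matrix (Fin n × Fin n) (Fin n × Fin n) ℂ) : Matrix (Fin n × Fin n) (Fin n × Fin n) ℂ :=
  Matrix.of fun x y => M (x.1, y.2) (y.1, x.2)

/-- Entries of the partial transpose. -/
theorem ptr_apply (M : Matrix (Fin n × Fin n) (Fin n × Fin n) ℂ) (x y : Fin n × Fin n) :
    ptr M x y = M (x.1, y.2) (y.1, x.2) := rfl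

/-- Reindexing a double sum over `(ℂ^n ⊗ ℂ^n)²` along the partial-transpose involution. -/
theorem sum_sum_ptr_reindex {M : Type*} [AddCommMonoid M] (F : (Fin n × Fin n) → (Fin n × Fin n) → M) :
    (∑ p, ∑ q, F p q) = ∑ x : Fin n × Fin n, ∑ y : Fin n × Fin n, F (x.1, y.2) (y.1, x.2) := by
  rw [Fintype.sum_prod_type, Fintype.sum_prod_type]
  simp_rw [Fintype.sum_prod_type (f := fun q : Fin n × Fin n => F _ q),
    Fintype.sum_prod_type (f := fun y : Fin n × Fin n => F (_, y.2) (y.1, _))]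
  -- Σ_{x1} Σ_{x2} Σ_{y1} Σ_{y2} F (x1,y2) (y1,x2)  versus  Σ_{p1} Σ_{p2} Σ_{q1} Σ_{q2} F (p1,p2) (q1,q2)
  refine Finset.sum_congr rfl fun p1 _ => ?_
  calc (∑ p2 : Fin n, ∑ q1 : Fin n, ∑ q2 : Fin n, F (p1, p2) (q1, q2))
      = ∑ p2 : Fin n, ∑ q2 : Fin n, ∑ q1 : Fin n, F (p1, p2) (q1, q2) :=
        Finset.sum_congr rfl fun p2 _ => Finset.sum_comm
    _ = ∑ q2 : Fin n, ∑ p2 : Fin n, ∑ q1 : Fin n, F (p1, p2) (q1, q2) := Finset.sum_comm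
    _ = ∑ q2 : Fin n, ∑ q1 : Fin n, ∑ p2 : Fin n, F (p1, p2) (q1, q2) :=
        Finset.sum_congr rfl fun q2 _ => Finset.sum_comm

/-- The partial transpose of a Hermitian matrix is Hermitian. -/
theorem ptr_isHermitian {M : Matrix (Fin n × Fin n) (Fin n × Fin n) ℂ} (hM : M.IsHermitian) :
    (ptr M).IsHermitian := by
  ext x y
  rw [Matrix.conjTranspose_apply, ptr_apply, ptr_apply, ← hM.apply (x.1, y.2) (y.1, x.2)]

/-- A matrix is a CONTRACTION (in coordinates). -/
def IsContr {ι : Type*} [Fintype ι] (X : Matrix ι ι ℂ) : Prop := ∀ w : ι → ℂ, nsq (X *ᵥ w) ≤ nsq w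

/-- The Frobenius mass of a contraction is at most the dimension. -/
theorem frob_le_card_of_isContr {ι : Type*} [Fintype ι] [DecidableEq ι] (X : Matrix ι ι ℂ)
    (hX : IsContr X) : (∑ x, ∑ y, ‖X x y‖ ^ 2) ≤ Fintype.card ι := by
  rw [Finset.sum_comm]
  calc (∑ y, ∑ x, ‖X x y‖ ^ 2) = ∑ y, nsq (X *ᵥ (Pi.single y 1 : ι → ℂ)) := by
        refine Finset.sum_congr rfl fun y _ => ?_
        rw [Matrix.mulVec_single_one]; rfl
    _ ≤ ∑ y, nsq (Pi.single y 1 : ι → ℂ) := Finset.sum_le_sum fun y _ => hX _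
    _ = ∑ _y : ι, (1 : ℝ) := by
        refine Finset.sum_congr rfl fun y _ => ?_
        unfold nsq
        rw [Finset.sum_eq_single y]
        · simp
        · intro x _ hx; simp [Pi.single_eq_of_ne hx]
        · intro h; exact absurd (Finset.mem_univ _) h
    _ = Fintype.card ι := by simp

/-- The SIGN OPERATOR of a Hermitian matrix: `Σ_i ε_i |u_i⟩⟨u_i|` over the eigenvector basis, with the signs
of the eigenvalues. -/
def signOp {ι : Type*} [Fintype ι] [DecidableEq ι] {H : Matrix ι ι ℂ} (hH : H.IsHermitian) : Matrix ι ι ℂ :=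
  ∑ i, ((if 0 ≤ hH.eigenvalues i then (1 : ℝ) else -1 : ℝ) : ℂ) • rankOneProj (⇑(hH.eigenvectorBasis i))

/-- Entries of the sign operator. -/
theorem signOp_apply {ι : Type*} [Fintype ι] [DecidableEq ι] {H : Matrix ι ι ℂ} (hH : H.IsHermitian) (x y : ι) :
    signOp hH x y = ∑ i, ((if 0 ≤ hH.eigenvalues i then (1 : ℝ) else -1 : ℝ) : ℂ) *
      ((hH.eigenvectorBasis i) x * conj ((hH.eigenvectorBasis i) y)) := by
  simp only [signOp, Matrix.sum_apply, Matrix.smul_apply, smul_eq_mul, rankOneProj_apply]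

/-- The sign operator is Hermitian. -/
theorem signOp_isHermitian {ι : Type*} [Fintype ι] [DecidableEq ι] {H : Matrix ι ι ℂ} (hH : H.IsHermitian) :
    (signOp hH).IsHermitian := by
  ext x y
  rw [Matrix.conjTranspose_apply, signOp_apply, signOp_apply, star_sum]
  refine Finset.sum_congr rfl fun i _ => ?_
  simp only [star_mul', Complex.star_def, Complex.conj_conj, Complex.conj_ofReal]
  ring

/-- The sign operator acts by `w ↦ Σ_i ε_i ⟨u_i, w⟩ u_i`. -/
theorem signOp_mulVec {ι : Type*} [Fintype ι] [DecidableEq ι] {H : Matrix ι ι ℂ} (hH : H.IsHermitian)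
    (w : ι → ℂ) :
    signOp hH *ᵥ w = ∑ i, (((if 0 ≤ hH.eigenvalues i then (1 : ℝ) else -1 : ℝ) : ℂ) *
      ∑ y, conj ((hH.eigenvectorBasis i) y) * w y) • ⇑(hH.eigenvectorBasis i) := by
  funext x
  simp only [Matrix.mulVec, dotProduct, signOp_apply, Finset.sum_apply, Pi.smul_apply, smul_eq_mul,
    Finset.sum_mul, Finset.mul_sum]
  rw [Finset.sum_comm]
  refine Finset.sum_congr rfl fun i _ => Finset.sum_congr rfl fun y _ => ?_
  ring

/-- The sign operator is a contraction (indeed an isometry). -/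
theorem signOp_isContr {ι : Type*} [Fintype ι] [DecidableEq ι] {H : Matrix ι ι ℂ} (hH : H.IsHermitian) :
    IsContr (signOp hH) := by
  intro w
  rw [signOp_mulVec, nsq_sum_smul_of_orthonormal _ (eigvec_orthonormal hH),
    nsq_eq_sum_of_orthonormal _ (eigvec_orthonormal hH) w (eigvec_expand hH w)]
  refine Finset.sum_le_sum fun i _ => ?_
  rw [norm_mul]
  have : ‖(((if 0 ≤ hH.eigenvalues i then (1 : ℝ) else -1 : ℝ)) : ℂ)‖ = 1 := by
    split_ifs <;> simp
  rw [this, one_mul]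

/-- The signed sum of diagonal quadratic forms is a trace against the partial transpose of the sign operator:
`Σ_i ε_i ⟨u_i, (ptr R) u_i⟩ = Σ_{p,q} R p q · (ptr X) q p`, `X = signOp`. -/
theorem sum_sign_quadform_eq_trace {R : Matrix (Fin n × Fin n) (Fin n × Fin n) ℂ} (hH : (ptr R).IsHermitian) :
    (∑ i, ((if 0 ≤ hH.eigenvalues i then (1 : ℝ) else -1 : ℝ) : ℂ) *
        (star (⇑(hH.eigenvectorBasis i) : Fin n × Fin n → ℂ) ⬝ᵥ (ptr R *ᵥ ⇑(hH.eigenvectorBasis i)))) =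
      ∑ p, ∑ q, R p q * ptr (signOp hH) q p := by
  symm
  calc (∑ p, ∑ q, R p q * ptr (signOp hH) q p)
      = ∑ x : Fin n × Fin n, ∑ y : Fin n × Fin n, R (x.1, y.2) (y.1, x.2) * signOp hH y x := by
        rw [sum_sum_ptr_reindex (F := fun p q => R p q * ptr (signOp hH) q p)]
        rfl
    _ = ∑ x : Fin n × Fin n, ∑ y : Fin n × Fin n, ∑ i,
          ((if 0 ≤ hH.eigenvalues i then (1 : ℝ) else -1 : ℝ) : ℂ) *
            (conj ((hH.eigenvectorBasis i) x) * (R (x.1, y.2) (y.1, x.2) * (hH.eigenvectorBasis i) y)) := by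
        refine Finset.sum_congr rfl fun x _ => Finset.sum_congr rfl fun y _ => ?_
        rw [signOp_apply, Finset.mul_sum]
        exact Finset.sum_congr rfl fun i _ => by ring
    _ = ∑ x : Fin n × Fin n, ∑ i, ∑ y : Fin n × Fin n,
          ((if 0 ≤ hH.eigenvalues i then (1 : ℝ) else -1 : ℝ) : ℂ) *
            (conj ((hH.eigenvectorBasis i) x) * (R (x.1, y.2) (y.1, x.2) * (hH.eigenvectorBasis i) y)) :=
        Finset.sum_congr rfl fun x _ => Finset.sum_comm
    _ = ∑ i, ∑ x : Fin n × Fin n, ∑ y : Fin n × Fin n,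
          ((if 0 ≤ hH.eigenvalues i then (1 : ℝ) else -1 : ℝ) : ℂ) *
            (conj ((hH.eigenvectorBasis i) x) * (R (x.1, y.2) (y.1, x.2) * (hH.eigenvectorBasis i) y)) :=
        Finset.sum_comm
    _ = _ := by
        refine Finset.sum_congr rfl fun i _ => ?_
        have hq : star (⇑(hH.eigenvectorBasis i) : Fin n × Fin n → ℂ) ⬝ᵥ (ptr R *ᵥ ⇑(hH.eigenvectorBasis i))
            = ∑ x : Fin n × Fin n, ∑ y : Fin n × Fin n,
                conj ((hH.eigenvectorBasis i) x) * (R (x.1, y.2) (y.1, x.2) * (hH.eigenvectorBasis i) y) := by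
          unfold dotProduct Matrix.mulVec
          refine Finset.sum_congr rfl fun x _ => ?_
          rw [Pi.star_apply, RCLike.star_def, dotProduct, Finset.mul_sum]
          rfl
        rw [hq, Finset.mul_sum]
        refine Finset.sum_congr rfl fun x _ => ?_
        rw [Finset.mul_sum]

/-- Rows of a vector of `ℂ^n ⊗ ℂ^n` in a coordinate frame `b` of the first factor:
`row b φ j = (μ' ↦ Σ_μ conj(b j μ) φ(μ,μ'))`. -/
def row (b : Fin n → Fin n → ℂ) (φ : Fin n × Fin n → ℂ) (j : Fin n) : Fin n → ℂ :=
  fun μ' => ∑ μ, conj (b j μ) * φ (μ, μ')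

/-- **Key inequality.** For a Hermitian contraction `X` on `ℂ^n ⊗ ℂ^n`, any vector `φ` and any orthonormal
coordinate frame `b` of the first factor: `nsq ((ptr X) φ) ≤ n · (Σ_j ‖row_j φ‖)²`. -/
theorem nsq_ptr_mulVec_le (X : Matrix (Fin n × Fin n) (Fin n × Fin n) ℂ) (hXh : X.IsHermitian)
    (hXc : IsContr X) (b : Fin n → Fin n → ℂ)
    (hb : ∀ j k, (∑ μ, conj (b j μ) * b k μ) = if j = k then 1 else 0)
    (hbc : ∀ w : Fin n → ℂ, w = ∑ j, (∑ μ, conj (b j μ) * w μ) • b j)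
    (φ : Fin n × Fin n → ℂ) :
    nsq (ptr X *ᵥ φ) ≤ n * (∑ j, Real.sqrt (nsq (row b φ j))) ^ 2 := by
  classical
  -- the pieces v_{j,μ}
  set v : Fin n → Fin n → Fin n → ℂ :=
    fun j μ μ' => ∑ l : Fin n, ∑ l' : Fin n, X (μ, l') (l, μ') * (b j l * row b φ j l') with hv
  -- (2) slices of (ptr X) φ are sums of the pieces
  have hslice : ∀ μ μ', (ptr X *ᵥ φ) (μ, μ') = ∑ j, v j μ μ' := by
    intro μ μ'
    have hφ : ∀ l l', φ (l, l') = ∑ j, b j l * row b φ j l' := by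
      intro l l'
      have h := congrFun (hbc fun l => φ (l, l')) l
      simp only [Finset.sum_apply, Pi.smul_apply, smul_eq_mul] at h
      rw [h]
      exact Finset.sum_congr rfl fun j _ => by rw [row, mul_comm]
    calc (ptr X *ᵥ φ) (μ, μ') = ∑ p : Fin n × Fin n, X (μ, p.2) (p.1, μ') * φ p := by
          simp only [Matrix.mulVec, dotProduct, ptr_apply]
      _ = ∑ l : Fin n, ∑ l' : Fin n, ∑ j, X (μ, l') (l, μ') * (b j l * row b φ j l') := by
          rw [Fintype.sum_prod_type]
          refine Finset.sum_congr rfl fun l _ => Finset.sum_congr rfl fun l' _ => ?_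
          rw [hφ l l', Finset.mul_sum]
      _ = ∑ l : Fin n, ∑ j, ∑ l' : Fin n, X (μ, l') (l, μ') * (b j l * row b φ j l') :=
          Finset.sum_congr rfl fun l _ => Finset.sum_comm
      _ = ∑ j, ∑ l : Fin n, ∑ l' : Fin n, X (μ, l') (l, μ') * (b j l * row b φ j l') := Finset.sum_comm
      _ = ∑ j, v j μ μ' := rfl
  -- (3) each piece is bounded by the row: nsq (v j μ) ≤ nsq (row j)
  have hpiece : ∀ j μ, nsq (v j μ) ≤ nsq (row b φ j) := by
    intro j μ
    set r := row b φ j with hr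
    set w : Fin n × Fin n → ℂ := fun a => if a.1 = μ then conj (r a.2) else 0 with hw
    have hXw : ∀ l μ', (X *ᵥ w) (l, μ') = ∑ l' : Fin n, X (l, μ') (μ, l') * conj (r l') := by
      intro l μ'
      simp only [Matrix.mulVec, dotProduct, hw]
      rw [Fintype.sum_prod_type]
      rw [Finset.sum_eq_single μ]
      · simp
      · intro a _ ha
        simp [ha]
      · intro h; exact absurd (Finset.mem_univ _) h
    have hvw : ∀ μ', v j μ μ' = ∑ l : Fin n, conj (conj (b j l)) * conj ((X *ᵥ w) (l, μ')) := by
      intro μ'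
      simp only [hv, hXw, map_sum, map_mul, Complex.conj_conj, Finset.mul_sum]
      refine Finset.sum_congr rfl fun l _ => Finset.sum_congr rfl fun l' _ => ?_
      rw [← hXh.apply (μ, l') (l, μ'), RCLike.star_def]
      ring
    have hcs : ∀ μ', ‖v j μ μ'‖ ^ 2 ≤ ∑ l : Fin n, ‖(X *ᵥ w) (l, μ')‖ ^ 2 := by
      intro μ'
      rw [hvw μ']
      have h := norm_sum_conj_mul_sq_le (fun l => conj (b j l)) (fun l => conj ((X *ᵥ w) (l, μ')))
      have hb1 : nsq (fun l => conj (b j l)) = 1 := by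
        have := nsq_sum_smul_of_orthonormal b hb (Pi.single j 1)
        rw [show (∑ k, (Pi.single j 1 : Fin n → ℂ) k • b k) = b j from ?_] at this
        · unfold nsq at this ⊢
          simp_rw [Complex.norm_conj]
          rw [this, Finset.sum_eq_single j]
          · simp
          · intro k _ hk; simp [Pi.single_eq_of_ne hk]
          · intro h'; exact absurd (Finset.mem_univ _) h'
        · rw [Finset.sum_eq_single j]
          · simp
          · intro k _ hk; simp [Pi.single_eq_of_ne hk]
          · intro h'; exact absurd (Finset.mem_univ _) h'
      rw [hb1, one_mul] at h
      refine h.trans (le_of_eq ?_)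
      unfold nsq
      simp_rw [Complex.norm_conj]
    calc nsq (v j μ) = ∑ μ', ‖v j μ μ'‖ ^ 2 := rfl
      _ ≤ ∑ μ', ∑ l : Fin n, ‖(X *ᵥ w) (l, μ')‖ ^ 2 := Finset.sum_le_sum fun μ' _ => hcs μ'
      _ = nsq (X *ᵥ w) := by
          unfold nsq
          rw [Fintype.sum_prod_type, Finset.sum_comm]
      _ ≤ nsq w := hXc w
      _ = nsq r := by
          unfold nsq
          rw [Fintype.sum_prod_type, Finset.sum_eq_single μ]
          · simp [hw]
          · intro a _ ha
            simp [hw, ha]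
          · intro h; exact absurd (Finset.mem_univ _) h
  -- (4) triangle inequality per slice, then sum over μ
  have hsl : ∀ μ, nsq (fun μ' => (ptr X *ᵥ φ) (μ, μ')) ≤ (∑ j, Real.sqrt (nsq (row b φ j))) ^ 2 := by
    intro μ
    have hfun : (fun μ' => (ptr X *ᵥ φ) (μ, μ')) = ∑ j, v j μ := by
      funext μ'; rw [hslice, Finset.sum_apply]
    rw [hfun, ← Real.sqrt_le_sqrt_iff (by positivity), Real.sqrt_sq (by positivity)]
    refine (sqrt_nsq_sum_le _ _).trans (Finset.sum_le_sum fun j _ => ?_)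
    exact Real.sqrt_le_sqrt (hpiece j μ)
  calc nsq (ptr X *ᵥ φ) = ∑ μ, nsq (fun μ' => (ptr X *ᵥ φ) (μ, μ')) := by
        unfold nsq; rw [Fintype.sum_prod_type]
    _ ≤ ∑ _μ : Fin n, (∑ j, Real.sqrt (nsq (row b φ j))) ^ 2 := Finset.sum_le_sum fun μ _ => hsl μ
    _ = n * (∑ j, Real.sqrt (nsq (row b φ j))) ^ 2 := by simp

end Ptr

section Frob

variable {n : ℕ}

/-- Frobenius mass of a weighted sum of eigen-projectors over a sub-family: `Σ_{p,q} |Σ_{i∈Λ} μ_i φ_i(p) conj φ_i(q)|² =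
Σ_{i∈Λ} μ_i²`. -/
theorem frob_partial_eigen {ι : Type*} [Fintype ι] [DecidableEq ι] {A : Matrix ι ι ℂ} (hA : A.IsHermitian)
    (Λ : Finset ι) :
    (∑ p, ∑ q, ‖∑ i ∈ Λ, (hA.eigenvalues i : ℂ) * ((hA.eigenvectorBasis i) p * conj ((hA.eigenvectorBasis i) q))‖ ^ 2)
      = ∑ i ∈ Λ, hA.eigenvalues i ^ 2 := by
  set φ := fun i => (⇑(hA.eigenvectorBasis i) : ι → ℂ) with hφ
  set μ := hA.eigenvalues with hμ
  have horth := eigvec_orthonormal hA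
  -- complex form
  have hC : (∑ p, ∑ q, conj (∑ i ∈ Λ, (μ i : ℂ) * (φ i p * conj (φ i q))) *
      (∑ i ∈ Λ, (μ i : ℂ) * (φ i p * conj (φ i q)))) = ∑ i ∈ Λ, ((μ i ^ 2 : ℝ) : ℂ) := by
    calc (∑ p, ∑ q, conj (∑ i ∈ Λ, (μ i : ℂ) * (φ i p * conj (φ i q))) *
          (∑ i ∈ Λ, (μ i : ℂ) * (φ i p * conj (φ i q))))
        = ∑ p, ∑ q, ∑ i ∈ Λ, ∑ i' ∈ Λ, (μ i : ℂ) * (μ i' : ℂ) *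
            ((conj (φ i p) * φ i' p) * (conj (φ i' q) * φ i q)) := by
          refine Finset.sum_congr rfl fun p _ => Finset.sum_congr rfl fun q _ => ?_
          rw [map_sum, Finset.sum_mul]
          refine Finset.sum_congr rfl fun i _ => ?_
          rw [Finset.mul_sum]
          refine Finset.sum_congr rfl fun i' _ => ?_
          simp only [map_mul, Complex.conj_conj, Complex.conj_ofReal]
          ring
      _ = ∑ i ∈ Λ, ∑ i' ∈ Λ, (μ i : ℂ) * (μ i' : ℂ) *
            ((∑ p, conj (φ i p) * φ i' p) * ∑ q, conj (φ i' q) * φ i q) := by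
          calc (∑ p, ∑ q, ∑ i ∈ Λ, ∑ i' ∈ Λ, (μ i : ℂ) * (μ i' : ℂ) *
                ((conj (φ i p) * φ i' p) * (conj (φ i' q) * φ i q)))
              = ∑ p, ∑ i ∈ Λ, ∑ q, ∑ i' ∈ Λ, (μ i : ℂ) * (μ i' : ℂ) *
                  ((conj (φ i p) * φ i' p) * (conj (φ i' q) * φ i q)) :=
                Finset.sum_congr rfl fun p _ => Finset.sum_comm
            _ = ∑ i ∈ Λ, ∑ p, ∑ q, ∑ i' ∈ Λ, (μ i : ℂ) * (μ i' : ℂ) *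
                  ((conj (φ i p) * φ i' p) * (conj (φ i' q) * φ i q)) := Finset.sum_comm
            _ = ∑ i ∈ Λ, ∑ p, ∑ i' ∈ Λ, ∑ q, (μ i : ℂ) * (μ i' : ℂ) *
                  ((conj (φ i p) * φ i' p) * (conj (φ i' q) * φ i q)) :=
                Finset.sum_congr rfl fun i _ => Finset.sum_congr rfl fun p _ => Finset.sum_comm
            _ = ∑ i ∈ Λ, ∑ i' ∈ Λ, ∑ p, ∑ q, (μ i : ℂ) * (μ i' : ℂ) *
                  ((conj (φ i p) * φ i' p) * (conj (φ i' q) * φ i q)) :=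
                Finset.sum_congr rfl fun i _ => Finset.sum_comm
            _ = _ := by
                refine Finset.sum_congr rfl fun i _ => Finset.sum_congr rfl fun i' _ => ?_
                rw [Finset.sum_mul_sum, Finset.mul_sum]
                refine Finset.sum_congr rfl fun p _ => ?_
                rw [Finset.mul_sum]
      _ = ∑ i ∈ Λ, ((μ i ^ 2 : ℝ) : ℂ) := by
          refine Finset.sum_congr rfl fun i hi => ?_
          rw [Finset.sum_eq_single_of_mem i hi]
          · rw [horth i i, if_pos rfl]
            all_goals (push_cast; ring)
          · intro i' _ hi'
            rw [horth i i', if_neg (Ne.symm hi'), zero_mul, mul_zero]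
  have hre : ∀ z : ℂ, conj z * z = ((‖z‖ ^ 2 : ℝ) : ℂ) := fun z => by
    rw [mul_comm, Complex.mul_conj, Complex.normSq_eq_norm_sq, Complex.ofReal_pow]
  simp_rw [hre] at hC
  exact_mod_cast hC


end Frob

/-- **Key inequality, unfolded statement (registered sub-goal `keyInequality`).** For a Hermitian contraction `X` on
`ℂ^n ⊗ ℂ^n`, an orthonormal coordinate frame `b` of the first factor and any `φ`:
`‖(X^Γ) φ‖² ≤ n · (Σ_j ‖row_j φ‖)²`. -/
theorem keyInequality {n : ℕ} (X : Matrix (Fin n × Fin n) (Fin n × Fin n) ℂ) (hXh : X.IsHermitian)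
    (hXc : ∀ w : Fin n × Fin n → ℂ, (∑ x, ‖(X.mulVec w) x‖ ^ 2) ≤ ∑ x, ‖w x‖ ^ 2)
    (b : Fin n → Fin n → ℂ)
    (hb : ∀ j k, (∑ μ, conj (b j μ) * b k μ) = if j = k then 1 else 0)
    (hbc : ∀ w : Fin n → ℂ, w = ∑ j, (∑ μ, conj (b j μ) * w μ) • b j)
    (φ : Fin n × Fin n → ℂ) :
    (∑ x, ‖((Matrix.of fun x y : Fin n × Fin n => X (x.1, y.2) (y.1, x.2)).mulVec φ) x‖ ^ 2) ≤
      n * (∑ j, Real.sqrt (∑ μ', ‖∑ μ, conj (b j μ) * φ (μ, μ')‖ ^ 2)) ^ 2 :=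
  nsq_ptr_mulVec_le X hXh hXc b hb hbc φ

end Summit.MatrixMultiplication.MatrixMultiplication.Theorems.DiagonalPowerDecay

end
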